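import Literature.Topology.FourManifolds.FlatHost
import Literature.Topology.FourManifolds.TemplateFlatten
import HarnessLib

/-!
# Flattening the host: the host of the flip frame is isotopic to the template knot

Topic `Literature/Topology/FourManifolds` (trunk T-4MAN). Fact seat
`provefact-Literature.Topology.FourManifolds.Knot.IsConnectedSum.isIsotopic` (Schubert's theorem),
geometric heart for rail knots, flattening step. By `FlatHost.hostLoop_eq` the host loop of the flip
frame at scale `κ` (family parameter `u = 0`) is the reparametrisation, by a lift of the circle, of the chart loop
`blowDown κ ∘ scaled σ₁ κ` (`chartLoop`); hence that chart loop is simple and regular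
(`isChartLoopN_chartLoop`) and its knot is isotopic to the host (`ReparamTools`). The **rescaling
family** `u ↦ blowDown κ ∘ scaled σ₁ (u κ)`, `u ∈ [0, 1]`, is jointly `C^∞` (Hadamard's lemma,
`ScaledTemplate.contDiff_scaled_uncurry`); for `u > 0` it is a homothetic image of the chart loop
at the smaller scale `u κ` (where the flat hypotheses still hold), hence simple and regular, and at
`u = 0` it is the blown-down template (`TemplateFlatten.isChartLoopN_blowDown_template`). The family
lemma (`CurveFamilyIsotopy`) gives **`host ≅ templateKnot`** (`FlatHyp.isIsotopic_host_templateKnot`).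

Everything is proved; no named facts are introduced.

## References

* M. W. Hirsch, *Differential Topology*, GTM 33 (1976), Ch. 8 §1, Thm. 1.3; proof of Thm. 1.6
  (the rescaling family). [HirschDT1976]
-/

open scoped Manifold ContDiff Topology Real
open Function Set Metric Filter

noncomputable section

namespace Literature.Topology.FourManifolds

/-- Local notation: `𝔼 n` is the model Euclidean space `EuclideanSpace ℝ (Fin n)`. -/
local notation "𝔼 " n:arg => EuclideanSpace ℝ (Fin n)

/-- Local notation: `𝕊 n` is the unit sphere in `EuclideanSpace ℝ (Fin (n + 1))`. -/
local notation "𝕊 " n:arg => (Metric.sphere (0 : EuclideanSpace ℝ (Fin (n + 1))) 1)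

attribute [local instance] fact_finrank_euclideanSpace_succ

open KnotsInBall ExitBend ModelTemplate

/-! ### Chart loops under injective affine maps -/

namespace IsChartLoopN

/-- **An injective affine image of a chart loop is a chart loop.** [folklore] -/
theorem affine {k : ℝ → 𝔼 3} (hk : IsChartLoopN k) (q : 𝔼 3) {L : (𝔼 3) →L[ℝ] 𝔼 3} (hL : Injective L) :
    IsChartLoopN fun s ↦ q + L (k s) := by
  refine ⟨contDiff_const.add (L.contDiff.comp hk.contDiff), fun s ↦ by simp only [hk.periodic s], fun s h0 ↦ ?_, fun s t hst ↦ ?_⟩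
  · have hd : HasDerivAt (fun s ↦ q + L (k s)) (L (deriv k s)) s :=
      (L.hasFDerivAt.comp_hasDerivAt s ((hk.contDiff.differentiable (by simp)) s).hasDerivAt).const_add q
    rw [hd.deriv] at h0
    exact hk.deriv_ne_zero s (hL (h0.trans (map_zero L).symm))
  · exact hk.inj s t (hL (add_left_cancel hst))

end IsChartLoopN

namespace BandData

variable {A₁ B₁ K₁ : Knot} {b₁ : BandData A₁ B₁ K₁ ∅} {A₂ B₂ K₂ : Knot} {b₂ : BandData A₂ B₂ K₂ ∅}
  {hcross₁ : b₁.band ⁻¹' sphereEquator 2 ∩ squareNhd b₁.δ = {x ∈ squareNhd b₁.δ | x 0 = 2⁻¹}}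
  {hcross₂ : b₂.band ⁻¹' sphereEquator 2 ∩ squareNhd b₂.δ = {x ∈ squareNhd b₂.δ | x 0 = 2⁻¹}}

section Generic

variable (b₁) (hcross₁)

/-- **The chart loop at scale `κ`**: `blowDown κ ∘ scaled σ₁ κ`. [folklore] -/
def flatChartLoop (κ : ℝ) (p : ℝ) : 𝔼 3 := b₁.blowDown hcross₁ κ (b₁.scaled hcross₁ b₁.depthSign κ p)

/-- **The rescaling family** `u ↦ ψ⁻¹ ∘ blowDown κ ∘ scaled σ₁ (u κ)`. [folklore] -/
def flatFam (κ u s : ℝ) : 𝔼 4 :=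
  ((psiN.symm (b₁.blowDown hcross₁ κ (b₁.scaled hcross₁ b₁.depthSign (u * κ) s)) : 𝕊 3) : 𝔼 4)

/-- The chart loop is `C^∞`. [folklore] -/
theorem contDiff_flatChartLoop (κ : ℝ) : ContDiff ℝ ∞ (b₁.flatChartLoop hcross₁ κ) :=
  (b₁.contDiff_blowDown hcross₁ κ).comp (b₁.contDiff_scaled hcross₁ b₁.depthSign κ)

/-- The chart loop is `1`-periodic. [folklore] -/
theorem periodic_flatChartLoop (κ : ℝ) : Periodic (b₁.flatChartLoop hcross₁ κ) 1 := fun p ↦ by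
  simp only [flatChartLoop, b₁.periodic_scaled hcross₁ b₁.depthSign κ p]

/-- The rescaling family is jointly `C^∞`. [folklore] -/
theorem contDiff_flatFam (κ : ℝ) : ContDiff ℝ ∞ (uncurry (b₁.flatFam hcross₁ κ)) := by
  have h1 : ContDiff ℝ ∞ fun x : ℝ × ℝ ↦ b₁.scaled hcross₁ b₁.depthSign (x.1 * κ) x.2 := by
    have h := (b₁.contDiff_scaled_uncurry hcross₁ b₁.depthSign).comp
      ((contDiff_fst.mul contDiff_const).prodMk contDiff_snd : ContDiff ℝ ∞ fun x : ℝ × ℝ ↦ (x.1 * κ, x.2))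
    exact h
  exact BandData.contDiff_coe_psiN_symm.comp ((b₁.contDiff_blowDown hcross₁ κ).comp h1)

/-- **At nonzero `u` the rescaled chart loop is a homothetic image of the chart loop at scale
`u κ`**: `blowDown κ (scaled (uκ) s) = (pZero - u⁻¹ pZero) + u⁻¹ (flatChartLoop (uκ) s)`. [folklore] -/
theorem blowDown_scaled_eq (κ : ℝ) {u : ℝ} (hu : u ≠ 0) (s : ℝ) :
    b₁.blowDown hcross₁ κ (b₁.scaled hcross₁ b₁.depthSign (u * κ) s) =
      (b₁.pZero - u⁻¹ • b₁.pZero) + u⁻¹ • b₁.flatChartLoop hcross₁ (u * κ) s := by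
  simp only [flatChartLoop, blowDown, smul_add, smul_smul]
  rw [show u⁻¹ * (u * κ) = κ by field_simp]
  abel

end Generic

namespace FlatHyp

variable {ε₁ r₁ A₁' ε₂ r₂ ε₁' r₁' κ : ℝ} (H : FlatHyp hcross₁ hcross₂ ε₁ r₁ A₁' ε₂ r₂ ε₁' r₁' κ)
include H

/-! ### The chart loop of the host -/

/-- The host loop is the chart loop along the lift. [folklore] -/
theorem hostLoop_eq_chartLoop (t : ℝ) : H.hostLoop zero_mem01 t = ((psiN.symm (b₁.flatChartLoop hcross₁ κ (H.lift t)) : 𝕊 3) : 𝔼 4) :=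
  H.hostLoop_eq t

/-- **THE CHART LOOP IS A CHART LOOP** (simple and regular: it is the host loop read through the
inverse lift). [folklore] -/
theorem isChartLoopN_chartLoop : IsChartLoopN (b₁.flatChartLoop hcross₁ κ) := by
  have hlift := H.isLift_lift
  have hsurj := hlift.surjective
  have hcd := b₁.contDiff_flatChartLoop hcross₁ κ
  refine ⟨hcd, b₁.periodic_flatChartLoop hcross₁ κ, fun p hp ↦ ?_, fun p p' h ↦ ?_⟩
  · -- regularity: the host loop `G ∘ chartLoop ∘ lift` is regular
    obtain ⟨t, rfl⟩ := hsurj p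
    set G : (𝔼 3) → 𝔼 4 := fun y ↦ ((psiN.symm y : 𝕊 3) : 𝔼 4) with hG
    have hGs : ContDiff ℝ ∞ G := BandData.contDiff_coe_psiN_symm
    have hc : HasDerivAt (b₁.flatChartLoop hcross₁ κ) (deriv (b₁.flatChartLoop hcross₁ κ) (H.lift t)) (H.lift t) :=
      ((hcd.differentiable (by simp)) _).hasDerivAt
    have h1 : HasDerivAt (fun t ↦ G (b₁.flatChartLoop hcross₁ κ (H.lift t)))
        ((fderiv ℝ G (b₁.flatChartLoop hcross₁ κ (H.lift t))) (deriv H.lift t • deriv (b₁.flatChartLoop hcross₁ κ) (H.lift t))) t :=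
      ((hGs.differentiable (by simp)) _).hasFDerivAt.comp_hasDerivAt t (hc.scomp t (hlift.hasDerivAt t))
    rw [hp, smul_zero, map_zero] at h1
    have e : H.hostLoop zero_mem01 = fun t ↦ G (b₁.flatChartLoop hcross₁ κ (H.lift t)) := funext H.hostLoop_eq_chartLoop
    have hne := (H.isRegularLoop_hostLoop zero_mem01).deriv_ne_zero t
    rw [e, h1.deriv] at hne
    exact hne rfl
  · -- simplicity: from the host loop and the lift property
    obtain ⟨t, rfl⟩ := hsurj p
    obtain ⟨t', rfl⟩ := hsurj p'
    have hh : H.hostLoop zero_mem01 t = H.hostLoop zero_mem01 t' := by rw [H.hostLoop_eq_chartLoop t, H.hostLoop_eq_chartLoop t', h]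
    obtain ⟨m, hm⟩ := H.hostLoop_inj zero_mem01 t t' hh
    refine ⟨m, ?_⟩
    rw [show t' = t + m by linarith, hlift.add_int]; ring

/-- **The knot of the chart loop.** [folklore] -/
def chartKnot : Knot := H.isChartLoopN_chartLoop.toKnot

/-- **THE HOST IS ISOTOPIC TO THE KNOT OF THE CHART LOOP** (reparametrisation by the lift).
[cite: HirschDT1976, Ch. 8, Thm. 8.1.3 (p. 180) and proof of Thm. 8.3.3 (p. 186)] -/
theorem isIsotopic_host_chartKnot : (H.host zero_mem01).IsIsotopic H.chartKnot := by
  have hk := H.isChartLoopN_chartLoop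
  have hlift := H.isLift_lift
  have e : H.hostLoop zero_mem01 = (fun t ↦ ((psiN.symm (b₁.flatChartLoop hcross₁ κ t) : 𝕊 3) : 𝔼 4)) ∘ H.lift :=
    funext H.hostLoop_eq_chartLoop
  have h := hk.loop.isIsotopic_toKnot_comp_lift hlift hk.inj_coe
  rw [host_eq_toKnot, IsRegularLoop.toKnot_congr (H.isRegularLoop_hostLoop zero_mem01) (hk.loop.comp_lift hlift) (H.hostLoop_inj zero_mem01)
    (IsRegularLoop.simple_comp_lift hlift hk.inj_coe) e]
  exact h

/-! ### The rescaling family -/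

/-- **Every member of the rescaling family is a chart loop** (`u ∈ [0, 1]`), given the flat
hypotheses at all scales `≤ κ`. [folklore] -/
theorem isChartLoopN_fam (Hall : ∀ κ', 0 < κ' → κ' ≤ κ → FlatHyp hcross₁ hcross₂ ε₁ r₁ A₁' ε₂ r₂ ε₁' r₁' κ') {u : ℝ}
    (hu : u ∈ Icc (0 : ℝ) 1) : IsChartLoopN fun s ↦ b₁.blowDown hcross₁ κ (b₁.scaled hcross₁ b₁.depthSign (u * κ) s) := by
  have hκ := H.κ_pos
  rcases hu.1.eq_or_lt with h0 | h0
  · -- `u = 0`: the blown-down template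
    rw [← h0]
    simp only [zero_mul, b₁.scaled_zero hcross₁]
    exact b₁.isChartLoopN_blowDown_template hcross₁ hκ.ne' b₁.depthSign
  · -- `u > 0`: homothetic image of the chart loop at scale `u κ`
    have H' := Hall (u * κ) (mul_pos h0 hκ) (by nlinarith [hu.2])
    have hk := H'.isChartLoopN_chartLoop
    have e : (fun s ↦ b₁.blowDown hcross₁ κ (b₁.scaled hcross₁ b₁.depthSign (u * κ) s)) =
        fun s ↦ (b₁.pZero - u⁻¹ • b₁.pZero) + (u⁻¹ • ContinuousLinearMap.id ℝ (𝔼 3)) (b₁.flatChartLoop hcross₁ (u * κ) s) :=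
      funext fun s ↦ by rw [b₁.blowDown_scaled_eq hcross₁ κ h0.ne' s]; rfl
    rw [e]
    refine hk.affine _ fun x y hxy ↦ ?_
    simpa [smul_right_inj (inv_ne_zero h0.ne')] using hxy

/-- **THE KNOT OF THE CHART LOOP IS ISOTOPIC TO THE TEMPLATE KNOT** (the rescaling family).
[cite: HirschDT1976, Ch. 8 §1, Thm. 1.3] -/
theorem isIsotopic_chartKnot_templateKnot (Hall : ∀ κ', 0 < κ' → κ' ≤ κ → FlatHyp hcross₁ hcross₂ ε₁ r₁ A₁' ε₂ r₂ ε₁' r₁' κ') :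
    H.chartKnot.IsIsotopic (b₁.templateKnot hcross₁ H.κ_pos.ne' b₁.depthSign) := by
  have hκ := H.κ_pos
  have h1 := H.isChartLoopN_chartLoop
  have h0 := b₁.isChartLoopN_blowDown_template hcross₁ hκ.ne' b₁.depthSign
  have hreg : ∀ u ∈ Icc (0 : ℝ) 1, IsRegularLoop (b₁.flatFam hcross₁ κ u) := fun u hu ↦ (H.isChartLoopN_fam Hall hu).loop
  have hinj : ∀ u ∈ Icc (0 : ℝ) 1, ∀ s t, b₁.flatFam hcross₁ κ u s = b₁.flatFam hcross₁ κ u t → ∃ m : ℤ, t - s = m := fun u hu ↦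
    (H.isChartLoopN_fam Hall hu).inj_coe
  have e₁ : b₁.flatFam hcross₁ κ 1 = fun s ↦ ((psiN.symm (b₁.flatChartLoop hcross₁ κ s) : 𝕊 3) : 𝔼 4) := by
    funext s; simp [flatFam, flatChartLoop]
  have e₀ : b₁.flatFam hcross₁ κ 0 = fun s ↦ ((psiN.symm (b₁.blowDown hcross₁ κ (template b₁.depthSign s)) : 𝕊 3) : 𝔼 4) := by
    funext s; simp [flatFam, b₁.scaled_zero hcross₁]
  have hC : ContDiff ℝ ∞ (uncurry fun u ↦ b₁.flatFam hcross₁ κ (1 - u)) := by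
    have : (uncurry fun u ↦ b₁.flatFam hcross₁ κ (1 - u)) = uncurry (b₁.flatFam hcross₁ κ) ∘ fun x : ℝ × ℝ ↦ (1 - x.1, x.2) := by
      funext x; rfl
    rw [this]; exact (b₁.contDiff_flatFam hcross₁ κ).comp ((contDiff_const.sub contDiff_fst).prodMk contDiff_snd)
  have h := IsRegularLoop.isIsotopic_of_family_eq h1.loop h0.loop h1.inj_coe h0.inj_coe (C := fun u ↦ b₁.flatFam hcross₁ κ (1 - u)) hC
    (fun u hu ↦ hreg (1 - u) ⟨by linarith [hu.2], by linarith [hu.1]⟩)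
    (fun u hu ↦ hinj (1 - u) ⟨by linarith [hu.2], by linarith [hu.1]⟩) (by simpa using e₁) (by simpa using e₀)
  exact h

/-- **THE HOST OF THE FLIP FRAME IS ISOTOPIC TO THE TEMPLATE KNOT.**
[cite: HirschDT1976, Ch. 8 §1, Thm. 1.3; proof of Thm. 1.6] -/
theorem isIsotopic_host_templateKnot (Hall : ∀ κ', 0 < κ' → κ' ≤ κ → FlatHyp hcross₁ hcross₂ ε₁ r₁ A₁' ε₂ r₂ ε₁' r₁' κ') :
    (H.host zero_mem01).IsIsotopic (b₁.templateKnot hcross₁ H.κ_pos.ne' b₁.depthSign) :=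
  IsAmbientIsotopic.trans_holds H.isIsotopic_host_chartKnot (H.isIsotopic_chartKnot_templateKnot Hall)

end FlatHyp

/-- **EXISTENCE FORM**: for a flip pair in normal position there are flat hypotheses at every small
scale, and then the host of the flip frame at any such scale is isotopic to the template knot of
`b₁` at that scale. [cite: HirschDT1976, Ch. 8 §1, Thm. 1.3] -/
theorem exists_flatHyp_isIsotopic (hP : IsFlipPair b₁ b₂) (hA : A₁.InNorth) (hB : B₁.InSouth)
    (hAB : Disjoint (range A₁) (range B₁)) (hB₂ : B₂.InSouth) :
    ∃ ε₁ r₁ A₁' ε₂ r₂ ε₁' r₁' κ₀ : ℝ, 0 < κ₀ ∧ ∀ κ (hκ : 0 < κ), κ ≤ κ₀ →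
      ∃ H : FlatHyp hcross₁ hcross₂ ε₁ r₁ A₁' ε₂ r₂ ε₁' r₁' κ,
        (H.host FlatHyp.zero_mem01).IsIsotopic (b₁.templateKnot hcross₁ hκ.ne' b₁.depthSign) := by
  obtain ⟨ε₁, r₁, A₁', ε₂, r₂, ε₁', r₁', κ₀, hκ₀, hH⟩ := exists_flatHyp (hcross₁ := hcross₁) (hcross₂ := hcross₂) hP hA hB hAB hB₂
  refine ⟨ε₁, r₁, A₁', ε₂, r₂, ε₁', r₁', κ₀, hκ₀, fun κ hκ hle ↦ ⟨hH κ hκ hle, ?_⟩⟩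
  exact (hH κ hκ hle).isIsotopic_host_templateKnot fun κ' hκ' hle' ↦ hH κ' hκ' (hle'.trans hle)

end BandData

end Literature.Topology.FourManifolds
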